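import Summits.QuantumAdvantage.QuantumAdvantage.Theses.RandomOracleGauge

/-!
# Crux `DecoupledCoreAA` (stmt-QuantumAdvantage-17872) — line `l1-family`

Skeleton of the O'Donnell–Zhao–Wright structure (arXiv:1512.01603, eqn. (2.1)) for a one-block-decoupled
`q(y,z) = c₀ + Σ_i (±1)^{y_i} g_i(z)` bounded in `[0,1]`:
* bookkeeping (`stub_derivativeFamily`, provable): `Σ_i |g_i(z)| ≤ 1/2` POINTWISE in `z` (choose the signs `y`),
  `Var q = Σ_i ‖g_i‖₂²`, `Inf_{y_i} q = 4‖g_i‖₂²`, `Inf_{z_j} q = Σ_i ‖g_i − g_i^{⊕j}‖₂²`, and each `g_i` is a cube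
  polynomial of degree `≤ d`;
* so the crux is EXACTLY the analytic DICHOTOMY `stub_l1Family`: an ℓ¹-bounded family of degree-`d` polynomials on
  `{0,1}^N` whose total `L²`-mass is `≥ 1/(K₀ d^κ₀)` has EITHER a member of `L²`-mass `≥ C/d^c` (a heavy `y`-variable)
  OR a coordinate `j` with aggregate influence `Σ_i ‖g_i − g_i^{⊕j}‖₂² ≥ C/d^c` (a heavy `z`-variable).
  The second alternative is NECESSARY: the address family `g_a(z) = 1[z_{1..d} = a]`, `a ∈ {0,1}^d` (degree `d`,
  `Σ_a |g_a| ≡ 1`, total mass `1`, every member of mass `2^{-d}`) shows the "heavy member" form alone is false beyond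
  `e^{-O(d)}` — which is exactly the loss of the one-liner `Σ‖g_i‖₂ ≤ e^{d}Σ‖g_i‖₁`.
The composition `DecoupledCoreAA_of` is kernel-checked below (sorries only in the two stubs).
-/

set_option linter.dupNamespace false

open Literature.Computability.QuantumComplexity
open Summit.QuantumAdvantage.QuantumAdvantage.Theses.RandomOracleGauge

namespace Summit.QuantumAdvantage.QuantumAdvantage.Cruxes.DecoupledCoreAA.L1Family

/-! ### Named statements of the stubs (verbatim; `Registered.stub_*` below are the name-keyed aliases used as the
hypotheses of `DecoupledCoreAA_of` — the native skeleton audit admits a hypothesis by the last name component of its head) -/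

/-- Statement of `stub_derivativeFamily` (verbatim). -/
abbrev DerivativeFamilyStmt : Prop :=
    ∀ (N d : ℕ) (q : MvPolynomial (Fin (N + N)) ℝ) (c₀ : ℝ) (g : Fin N → (Fin N → Bool) → ℝ),
      (∀ (y z : Fin N → Bool),
          evalBool q (Fin.append y z) = c₀ + ∑ i, (if y i then (1 : ℝ) else -1) * g i z) →
      q.totalDegree ≤ d → (∀ x, 0 ≤ evalBool q x ∧ evalBool q x ≤ 1) →
      (∀ z, ∑ i, |g i z| ≤ 1 / 2) ∧
      (∀ i, influence (Fin.castAdd N i) q = 4 * boolAvg (fun z => g i z ^ 2)) ∧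
      (∀ j, influence (Fin.natAdd N j) q = ∑ i, boolAvg (fun z => (g i z - g i (flipBit j z)) ^ 2)) ∧
      boolVariance q = ∑ i, boolAvg (fun z => g i z ^ 2) ∧
      (∀ i, ∃ r : MvPolynomial (Fin N) ℝ, r.totalDegree ≤ d ∧ ∀ z, evalBool r z = g i z)

/-- Statement of `stub_l1Family` (verbatim). -/
abbrev L1FamilyStmt : Prop :=
    ∀ (κ₀ : ℕ) (K₀ : ℝ), 0 < K₀ → ∃ (c : ℕ) (C : ℝ), 0 < C ∧
      ∀ (N d : ℕ) (g : Fin N → MvPolynomial (Fin N) ℝ), 1 ≤ d → (∀ i, (g i).totalDegree ≤ d) →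
        (∀ z, ∑ i, |evalBool (g i) z| ≤ 1) →
        1 ≤ K₀ * (d : ℝ) ^ κ₀ * ∑ i, boolAvg (fun z => evalBool (g i) z ^ 2) →
        (∃ i, C / (d : ℝ) ^ c ≤ boolAvg (fun z => evalBool (g i) z ^ 2)) ∨
        (∃ j, C / (d : ℝ) ^ c ≤ ∑ i, boolAvg (fun z => (evalBool (g i) z - evalBool (g i) (flipBit j z)) ^ 2))

/-- STUB (bookkeeping, provable; size M). For a one-block-decoupled `q = c₀ + Σ_i (±1)^{y_i} g_i(z)`
with `0 ≤ q ≤ 1` on the cube and total degree `≤ d`: the signs can be aligned, so `Σ_i |g_i(z)| ≤ 1/2`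
for every `z`; flipping `y_i` changes `q` by `± 2 g_i(z)`, so `Inf_{y_i}[q] = 4 E_z[g_i²]`; flipping `z_j`
changes `q` by `Σ_i (±1)^{y_i}(g_i(z) − g_i(z^{⊕j}))`, so `Inf_{z_j}[q] = Σ_i E_z[(g_i − g_i^{⊕j})²]`; the
characters `(±1)^{y_i}` are orthonormal and mean-zero in `y`, so `Var q = Σ_i E_z[g_i²]`; and each
`g_i(z) = (q(y[i↦false], z) − q(y[i↦true], z))/2` is (the cube function of) a polynomial in `z` of total
degree `≤ d`. [cite: arXiv:1512.01603, eqn. (2.1)] -/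
theorem stub_derivativeFamily :
    ∀ (N d : ℕ) (q : MvPolynomial (Fin (N + N)) ℝ) (c₀ : ℝ) (g : Fin N → (Fin N → Bool) → ℝ),
      (∀ (y z : Fin N → Bool),
          evalBool q (Fin.append y z) = c₀ + ∑ i, (if y i then (1 : ℝ) else -1) * g i z) →
      q.totalDegree ≤ d → (∀ x, 0 ≤ evalBool q x ∧ evalBool q x ≤ 1) →
      (∀ z, ∑ i, |g i z| ≤ 1 / 2) ∧
      (∀ i, influence (Fin.castAdd N i) q = 4 * boolAvg (fun z => g i z ^ 2)) ∧
      (∀ j, influence (Fin.natAdd N j) q = ∑ i, boolAvg (fun z => (g i z - g i (flipBit j z)) ^ 2)) ∧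
      boolVariance q = ∑ i, boolAvg (fun z => g i z ^ 2) ∧
      (∀ i, ∃ r : MvPolynomial (Fin N) ℝ, r.totalDegree ≤ d ∧ ∀ z, evalBool r z = g i z) := by
  sorry

/-- STUB (the OPEN CORE in analytic form; size open-problem). ℓ¹-BOUNDED FAMILIES OF LOW-DEGREE POLYNOMIALS:
HEAVY MEMBER OR HEAVY COORDINATE, polynomially. For every regime `(κ₀, K₀)` there are `c, C > 0` such that for all
`N`, `d ≥ 1` and `g : Fin N → ℝ[x_1..x_N]` of total degree `≤ d` with `Σ_i |g_i(z)| ≤ 1` for every `z ∈ {0,1}^N`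
and `Σ_i E[g_i²] ≥ 1/(K₀ d^κ₀)`: either some `i` has `E[g_i²] ≥ C/d^c`, or some coordinate `j` has
`Σ_i E[(g_i − g_i^{⊕j})²] ≥ C/d^c`. (Equivalent to the crux by `stub_derivativeFamily`; the first alternative alone holds
with `e^{O(d)}` loss by the one-liner and is false polynomially: address family.)
[cite: arXiv:1512.01603, eqn. (2.1) and Thm. 2.13] -/
theorem stub_l1Family :
    ∀ (κ₀ : ℕ) (K₀ : ℝ), 0 < K₀ → ∃ (c : ℕ) (C : ℝ), 0 < C ∧
      ∀ (N d : ℕ) (g : Fin N → MvPolynomial (Fin N) ℝ), 1 ≤ d → (∀ i, (g i).totalDegree ≤ d) →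
        (∀ z, ∑ i, |evalBool (g i) z| ≤ 1) →
        1 ≤ K₀ * (d : ℝ) ^ κ₀ * ∑ i, boolAvg (fun z => evalBool (g i) z ^ 2) →
        (∃ i, C / (d : ℝ) ^ c ≤ boolAvg (fun z => evalBool (g i) z ^ 2)) ∨
        (∃ j, C / (d : ℝ) ^ c ≤ ∑ i, boolAvg (fun z => (evalBool (g i) z - evalBool (g i) (flipBit j z)) ^ 2)) := by
  sorry

namespace Registered

/-- Alias of `stub_derivativeFamily`'s statement keyed by the registered stub name. -/
abbrev stub_derivativeFamily : Prop := DerivativeFamilyStmt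
/-- Alias of `stub_l1Family`'s statement keyed by the registered stub name. -/
abbrev stub_l1Family : Prop := L1FamilyStmt

end Registered

/-- COMPOSITION (kernel-checked): the two stubs give the crux `DecoupledCoreAA` by name. -/
theorem DecoupledCoreAA_of (hFam : Registered.stub_derivativeFamily) (hCore : Registered.stub_l1Family) :
    DecoupledCoreAA := by
  intro κ₀ K₀ hK₀
  obtain ⟨c, C, hC, hX⟩ := hCore κ₀ K₀ hK₀
  refine ⟨c, C, hC, ?_⟩
  intro N d q hdec hd hdeg hb hreg
  obtain ⟨c₀, g, hg⟩ := hdec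
  obtain ⟨hl1, hinfy, hinfz, hvar, hpoly⟩ := hFam N d q c₀ g hg hdeg hb
  -- realise every `g i` as a polynomial `r i` of degree ≤ d
  choose r hrdeg hrev using hpoly
  have hsq : ∀ i, boolAvg (fun z => evalBool (r i) z ^ 2) = boolAvg (fun z => g i z ^ 2) := by
    intro i
    simp_rw [hrev i]
  have hdf : ∀ j i, boolAvg (fun z => (evalBool (r i) z - evalBool (r i) (flipBit j z)) ^ 2)
      = boolAvg (fun z => (g i z - g i (flipBit j z)) ^ 2) := by
    intro j i
    simp_rw [hrev i]
  -- hypotheses of the core for the family `r`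
  have hl1' : ∀ z, ∑ i, |evalBool (r i) z| ≤ 1 := by
    intro z
    simp_rw [hrev]
    linarith [hl1 z]
  have hreg' : 1 ≤ K₀ * (d : ℝ) ^ κ₀ * ∑ i, boolAvg (fun z => evalBool (r i) z ^ 2) := by
    simp_rw [hsq, ← hvar]
    exact hreg
  rcases hX N d r hd hrdeg hl1' hreg' with ⟨i, hi⟩ | ⟨j, hj⟩
  · -- a heavy `y`-variable
    refine ⟨Fin.castAdd N i, ?_⟩
    rw [hinfy i, ← hsq i]
    have h0 : 0 ≤ boolAvg (fun z => evalBool (r i) z ^ 2) := boolAvg_nonneg fun _ => sq_nonneg _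
    linarith
  · -- a heavy `z`-variable
    refine ⟨Fin.natAdd N j, ?_⟩
    rw [hinfz j]
    simp_rw [← hdf j]
    exact hj

/-- Wiring check: the stub theorems feed `DecoupledCoreAA_of` as stated (the verbatim restatements are definitionally the
registered aliases). An unnamed `example`, so that `DecoupledCoreAA_of` stays the only declaration concluding the crux by name. -/
example : DecoupledCoreAA :=
  DecoupledCoreAA_of stub_derivativeFamily stub_l1Family

end Summit.QuantumAdvantage.QuantumAdvantage.Cruxes.DecoupledCoreAA.L1Family
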